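import Summits.BirchSwinnertonDyer.Rank1Residual.X2.IsogenyClassStability
import Summits.BirchSwinnertonDyer.Rank1Residual.X2.RankOneHeegner
import Literature.NumberTheory.EllipticCurves.IsogenyIdProofs
import HarnessLib

/-!
# Crux 4 `BSDpOnCellC` (stmt-BirchSwinnertonDyer-19034), line b1 — the SPLIT multiplicative half of `CellC` REDUCES TO THE CURVES AT
# KELLER–YIN's NORMALISED LATTICE, at the `BSD(E,p)` level, granted Cassels + ONE normalisation sentence [NORM]
# (cell `bsd-eis`, width seat `bsd-line-x2-p2` gen 10; skeleton of record UNCHANGED, W-79)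

WHY. This seat's split chain ends (p679190, `SplitMultWallNonsplitExt.imprimitiveCount_split_of_br_of_pub_of_nonsplitExt`) at conj. 2 of the
wall for the curves `W` with «every rational `p`-line ramified at `p`» ∧ «at most one rational `p`-line» — Keller–Yin's standing normalisation
(arXiv:2402.12781v2 §0.1 L262–263: "By Ribet's Lemma we can find a sub-lattice … More precisely, we can fix a non-split extension
`0 → 𝔽(φ) → ρ̄_f → 𝔽(ψ) → 0` where the first character restricts to `ω` on `G_p` … We can assume this since both the Iwasawa Main Conjectures
and the BSD Conjecture is invariant under isogenies"). The LEAD's composition `BSDpOnCellC_of` consumes conj. 2 for EVERY X2c datum. This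
file shows, in the kernel, how the general split X2c pair reduces to a normalised one AT THE LEVEL OF `BSDp` — where the tree already holds
every transport: `CellC` is a `ℚ`-isogeny invariant (`X2.cellC_iff_of_isIsogenous`, unconditional), so is split multiplicative reduction at
`p` (`X2.IsogenyQuotientLine.hasSplitMultiplicativeReductionAtPrime_iff_of_isIsogenous`), and `BSD(·,p)` passes along a `ℚ`-isogeny at
analytic rank `≤ 1` (Cassels: `X2.bsdp_of_isIsogenous_of_bsdp`, granted `bsdRHS_eq_of_isIsogenous`, GZK `rank_eq_analyticRank_of_analyticRank_le_one`,
modularity `hasEntireLFunction_rat` — all three conjuncts of `stub_publishedFacts`). The ONE input not in the tree is the EXISTENCE of the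
normalised curve in the isogeny class, stated INLINE as the hypothesis `hnorm` ([NORM]): for `W/ℚ` globally minimal with `E[p]` reducible and
split multiplicative at an odd `p`, some `ℚ`-isogenous globally minimal `W'` has every rational `p`-line ramified at `p` and at most one
rational `p`-line. [NORM] = Ribet 1976 Prop. 2.1 (a lattice with non-split reduction and prescribed sub, for `V_p E` irreducible — Shafarevich /
Faltings, Silverman AEC IX.6.2) ∘ the lattice–isogeny dictionary (AEC III.4.12, Vélu; the tree HOLDS the one-step quotient
`X2.IsogenyQuotientLine.exists_isogeny_ker_eq_line` and the image-line analysis `X2.IsogenyLineType`, so [NORM] is, in the tree, the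
TERMINATION of the walk along the `p`-isogeny path — Mazur–Kenku: no rational cyclic `p^k`-isogeny with `p^k ∉ {≤ 19, 21, 25, 27, 37, 43, 67, 163}`).

RESULT. `bsdp_of_cellC_split_of_normalised`: [NORM] + Cassels/GZK/modularity + «`BSDp` for every NORMALISED split X2c pair at `p`» ⟹ `BSDp`
for EVERY split X2c pair at `p`; and `normalised_self` — a curve already at the normalised lattice is its own witness (the trivial case of
[NORM], `isIsogenous_self`). So a v13 cut of line b1 may restrict conj. 2 of the wall to normalised curves (this seat's p679190 shape: SIX PUB +
[BR𝟙] + [BRω-split] + [AN-split]) at the price of [NORM] (published) in `stub_publishedFacts`' style and a composition that normalises `W`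
first. Nothing of the kind is registered here (W-79).

HONEST FRAMING: helper theorems only (0 defs, 0 named facts introduced, 0 sorry); CONDITIONAL on the inline [NORM] and on the three named
published facts; closes no stub; no summit statement / BSD / MC / IMC is proved for any curve; 0 cells / labels / tiers move.

References: [KellerYin2024] §0.1 L262–263, §1.3 L886 (arXiv:2402.12781v2); [Ribet1976] Prop. 2.1; [SilvermanAEC2009] III.4.12, VII.7.2, IX.6.2;
[Mazur1978] Thm. 1; [Kenku1982] Thm. 1; [Cassels1965ArithmeticVIII]; [MilneADT2006] Thm. I.7.3; [GreenbergVatsal2000] §2 p. 28 (the one-step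
reduction `E' = E/Φ`); cell files `X2/IsogenyClassStability`, `X2/IsogenyQuotientLine`, `X2/IsogenyLineType`, `X2/RankOneHeegner` (b2b-bsdres).
-/

set_option autoImplicit false
set_option linter.dupNamespace false -- the summit namespace `…BirchSwinnertonDyer.BirchSwinnertonDyer.Theorems` (Sub = Summit, D-0017) trips it

noncomputable section

open scoped Classical

namespace Summit.BirchSwinnertonDyer.BirchSwinnertonDyer.Theorems.SplitMultNormalisation

open WeierstrassCurve NumberField IsDedekindDomain Field
open Literature.NumberTheory.EllipticCurves Literature.NumberTheory.EllipticCurves.Rank1Residual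
  Summit.BirchSwinnertonDyer.Rank1Residual Summit.BirchSwinnertonDyer.Rank1Residual.X2

/-- **Keller–Yin's normalised lattice, as a predicate on `(W, p)`** (used only as an abbreviation inside this file's statements; it is the
conjunction of the two `W`-intrinsic binders of p679190): every rational `p`-line of `W` is ramified at `p`, and `W` has at most one rational
`p`-line (so `W[p]` is a non-split extension `0 → 𝔽(φ) → W[p] → 𝔽(ψ) → 0` with `φ|_{G_p} = ω`). Spelled out, not a definition.
[cite: KellerYin2024, §0.1 (arXiv:2402.12781v2 TeX L262–263) and §1.3 (L886)] -/
theorem normalised_self (W : WeierstrassCurve ℚ) [W.IsElliptic] [W.IsGloballyMinimal] (p : ℕ) [Fact p.Prime]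
    (hlat : ∀ Φ : AddSubgroup (geomTorsion W (p : ℤ)), IsRationalLine W p Φ → ¬ LineUnramifiedAt W p Φ)
    (huniq : ∀ Φ Φ' : AddSubgroup (geomTorsion W (p : ℤ)), IsRationalLine W p Φ → IsRationalLine W p Φ' → Φ = Φ') :
    ∃ (W' : WeierstrassCurve ℚ) (_ : W'.IsElliptic) (_ : W'.IsGloballyMinimal), IsIsogenous W W' ∧
      (∀ Φ : AddSubgroup (geomTorsion W' (p : ℤ)), IsRationalLine W' p Φ → ¬ LineUnramifiedAt W' p Φ) ∧
      (∀ Φ Φ' : AddSubgroup (geomTorsion W' (p : ℤ)), IsRationalLine W' p Φ → IsRationalLine W' p Φ' → Φ = Φ') :=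
  ⟨W, inferInstance, inferInstance, isIsogenous_self W, hlat, huniq⟩

/-- **The split multiplicative half of X2c reduces to the normalised curves, at the `BSD(E,p)` level.** GRANTED [NORM] (`hnorm`, inline: every
globally minimal `W/ℚ` with `E[p]` reducible and split multiplicative reduction at an odd `p` is `ℚ`-isogenous to a globally minimal `W'`
at Keller–Yin's normalised lattice — Ribet 1976 Prop. 2.1 ∘ Vélu ∘ Mazur–Kenku / Shafarevich), Cassels (`bsdRHS_eq_of_isIsogenous`), GZK
(`rank_eq_analyticRank_of_analyticRank_le_one`) and modularity (`hasEntireLFunction_rat`): if `BSDp W' p` holds for every NORMALISED split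
X2c pair `(W', p)`, then `BSDp W p` holds for EVERY split X2c pair `(W, p)`. Proof: `CellC` and split multiplicative reduction at `p` are
`ℚ`-isogeny invariants (`cellC_iff_of_isIsogenous`, `hasSplitMultiplicativeReductionAtPrime_iff_of_isIsogenous`), and `BSD(·,p)` passes along a
`ℚ`-isogeny at analytic rank `≤ 1` (`bsdp_of_isIsogenous_of_bsdp`).
[cite: KellerYin2024, §0.1 (arXiv:2402.12781v2 TeX L262–263: "We can assume this since … the BSD Conjecture is invariant under isogenies")]
[cite: Ribet1976, Prop. 2.1] [cite: MilneADT2006, Thm. I.7.3] [cite: Cassels1965ArithmeticVIII] [cite: SilvermanAEC2009, Prop. III.4.12 and Cor. VII.7.2] -/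
theorem bsdp_of_cellC_split_of_normalised
    (hCassels : bsdRHS_eq_of_isIsogenous) (hGZK : rank_eq_analyticRank_of_analyticRank_le_one)
    (hmod : hasEntireLFunction_rat)
    (hnorm : ∀ (W : WeierstrassCurve ℚ) [W.IsElliptic] [W.IsGloballyMinimal] (p : ℕ) [Fact p.Prime],
      p ≠ 2 → Red W p → W.HasSplitMultiplicativeReductionAtPrime p →
      ∃ (W' : WeierstrassCurve ℚ) (_ : W'.IsElliptic) (_ : W'.IsGloballyMinimal), IsIsogenous W W' ∧
        (∀ Φ : AddSubgroup (geomTorsion W' (p : ℤ)), IsRationalLine W' p Φ → ¬ LineUnramifiedAt W' p Φ) ∧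
        (∀ Φ Φ' : AddSubgroup (geomTorsion W' (p : ℤ)), IsRationalLine W' p Φ → IsRationalLine W' p Φ' → Φ = Φ'))
    (p : ℕ) [Fact p.Prime]
    (hroad : ∀ (W' : WeierstrassCurve ℚ) [W'.IsElliptic] [W'.IsGloballyMinimal],
      CellC W' p → W'.HasSplitMultiplicativeReductionAtPrime p →
      (∀ Φ : AddSubgroup (geomTorsion W' (p : ℤ)), IsRationalLine W' p Φ → ¬ LineUnramifiedAt W' p Φ) →
      (∀ Φ Φ' : AddSubgroup (geomTorsion W' (p : ℤ)), IsRationalLine W' p Φ → IsRationalLine W' p Φ' → Φ = Φ') →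
      BSDp W' p)
    (W : WeierstrassCurve ℚ) [W.IsElliptic] [W.IsGloballyMinimal] (hc : CellC W p)
    (hsplit : W.HasSplitMultiplicativeReductionAtPrime p) : BSDp W p := by
  have hp2 : p ≠ 2 := hc.2.1
  have hred : Red W p := hc.2.2.1
  obtain ⟨W', hE', hmin', hiso, hlat', huniq'⟩ := hnorm W p hp2 hred hsplit
  have hc' : CellC W' p := (cellC_iff_of_isIsogenous (p := p) hiso).mp hc
  have hsplit' : W'.HasSplitMultiplicativeReductionAtPrime p :=
    (IsogenyQuotientLine.hasSplitMultiplicativeReductionAtPrime_iff_of_isIsogenous (p := p) hiso).mp hsplit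
  have h' : BSDp W' p := hroad W' hc' hsplit' hlat' huniq'
  have hr' : W'.analyticRank ≤ 1 := by rw [hc'.1]
  exact bsdp_of_isIsogenous_of_bsdp hCassels hGZK hmod W' W hiso.symm_of_charZero p hr' h'

end Summit.BirchSwinnertonDyer.BirchSwinnertonDyer.Theorems.SplitMultNormalisation

end
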